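import Summits.QuantumFields.YangMills.Theorems.FemtoCutoffLadderOctaveStepDecayTraceEquivalence
import Summits.QuantumFields.YangMills.Theorems.FemtoCutoffLadderAssemblyTelescopingR1

/-!
# Crux `SubOctaveBounded` (stmt-QuantumFields-24085) — the registered `trace` line is an EXACT reformulation:
# `SubOctaveTraceComparison ↔ SubOctaveBounded`, kernel-checked in both directions

Seat `ym-line-fcl-p3` (2026-08-28; explicit-unit prover seat of route `FemtoCutoffLadder`, parked target «24153 or 24085» of WAKE-fcl-p3).
Rung R2b1 = the RECORD-label femto transfer gap `FemtoGapOfRecord`: NOT the Clay gap, not infinite volume, no summit.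

The registered skeleton `Cruxes.SubOctaveBounded.Trace` (planner ym-idea-1 g2, evidence `SubOctaveBounded_trace_skeleton.lean`) reduces the
crux to `stub_excitedRatioUpper` (LANDED by reuse: `Cruxes.OctaveStepDecay.Trace.stub_excitedRatioUpper`) and the HARD stub
`stub_subOctaveTraceComparison : SubOctaveTraceComparison` (`FemtoCutoffLadderTraceDefs.lean`: for one incommensurable pair `L₀ ≤ L' ≤ L < 2L'`
at matched two-loop label, the fine EXCITED TRACE RATIO after `L·t` transfer steps is bounded by the coarse one after `L'·t` steps — the same
physical time `t` — up to `M·exp(CΛ²·t)`).  Companion of `FemtoCutoffLadderOctaveStepDecayTraceEquivalence.lean`; this file records, sorry-free: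

* `subOctaveBounded_of_subOctaveTraceComparison : SubOctaveTraceComparison → SubOctaveBounded` — the skeleton's composition with the landed
  stub discharged (root test in `t`; proof adapted from the planner's registered skeleton);
* `subOctaveTraceComparison_of_subOctaveBounded : SubOctaveBounded → SubOctaveTraceComparison` — the CONVERSE: from
  `(λ₁/λ₀)_f^{L} ≤ e^{CΛ²}·(λ₁/λ₀)_c^{L'}` and `E_f(Lt) ≤ (λ₁/λ₀)_f^{Lt−2}E_f(2)`, `(λ₁/λ₀)_c^{L't} ≤ E_c(L't)`, the comparison holds for every
  `t ≥ 2` with the explicit prefactor `M = E_f(2)/(λ₁/λ₀)_f²`;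
* ★ `subOctaveTraceComparison_iff : SubOctaveTraceComparison ↔ SubOctaveBounded`;
* §3 `stepCruxes_of_uniformStepR1` — HIERARCHY: the retired all-pairs step in its repaired form R1 (lead's
  `Cruxes/UniformStepScaling/Misstated.md`; hypothesis spelled out, it is the `hS` of `CutoffLadder.femtoGapOfRecord_of_ladderR1`) implies
  `OctaveStepDecay ∧ SubOctaveBounded` (tower pairs are among its pairs; on a sub-octave pair `CΛ²/L'^σ + D(1/β' − 1/β) ≤ (max(C,0) + D·lam₀)Λ²`
  by `1/β' ≤ Λ³/2`): the rev-6/9 restatement 23836 → {24153, 24085} only WEAKENED the route's step obligations.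

READING FOR THE PLANNER (D-0014): as for `OctaveStepDecay`, the `trace` line's single open stub is the crux itself modulo fixed-lattice spectral
bookkeeping already in the tree — difficulty reduction ZERO; it sits behind `Literature.Barriers.QuantumFields.UVStabilityNonUniqueness` exactly
as the crux does.  HONEST FRAMING: nothing here is a two-cutoff estimate; no definitions, no named facts, no `sorry`.
-/

set_option autoImplicit false

noncomputable section

namespace Summit.QuantumFields.YangMills.Theorems.FemtoCutoffLadder.Trace

open Real
open Summit.QuantumFields.YangMills.Theorems.FemtoTransferGap
open Summit.QuantumFields.YangMills.Theses.FemtoCutoffLadder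

/-! ### §1. `SubOctaveTraceComparison → SubOctaveBounded` (the skeleton's composition, landed stub discharged) -/

/-- **Stub ⇒ crux** (the registered skeleton's composition `subOctaveBounded_of_parts` with `ExcitedRatioUpper` discharged by the landed stub):
chain `(λ₁/λ₀)_f^{Lt} ≤ E_f(Lt) ≤ M e^{CΛ²t} E_c(L't) ≤ M e^{CΛ²t} (λ₁/λ₀)_c^{L't−2} E_c(2)`, root test in `t`, clear denominators.  Proof adapted
from the planner's registered skeleton `SubOctaveBounded_trace_skeleton.lean`. [cite: MontvayMunster1994, (3.145)] [cite: ReedSimonIV1978, Thm. XIII.1] -/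
theorem subOctaveBounded_of_subOctaveTraceComparison (h1 : SubOctaveTraceComparison) : SubOctaveBounded := by
  obtain ⟨C, lam0, L0, hlam0, H⟩ := h1
  refine ⟨C, lam0, L0, hlam0, ?_⟩
  intro lam hlam hle L' _ L _ hL0 hL'L hL2 β β' hW hW' hm
  obtain ⟨M, t0, HT⟩ := H lam hlam hle L' L hL0 hL'L hL2 β β' hW hW' hm
  set s : ℝ := C * luscherLambda β L ^ 2 with hsdef
  have hbf : 0 < topValue su2Rep L β := topValue_su2Rep_pos L β
  have hbc : 0 < topValue su2Rep L' β' := topValue_su2Rep_pos L' β'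
  set rf : ℝ := secondValue su2Rep L β / topValue su2Rep L β with hrfdef
  set rc : ℝ := secondValue su2Rep L' β' / topValue su2Rep L' β' with hrcdef
  have hrf : 0 < rf := ratio_pos_of_window hW
  have hrc : 0 < rc := ratio_pos_of_window hW'
  have hLpos : 1 ≤ L := Nat.pos_of_ne_zero (NeZero.ne L)
  have hL'pos : 1 ≤ L' := Nat.pos_of_ne_zero (NeZero.ne L')
  set E2 : ℝ := excitedRatio L' β' 2 with hE2def
  have hE2 : 0 < E2 := excitedRatio_pos hW' le_rfl
  set t1 : ℕ := max t0 2 with ht1def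
  -- the chained bound for t ≥ t1:  rf^(L t) ≤ M e^{s t} rc^(L' t - 2) E2
  have hchain : ∀ t : ℕ, t1 ≤ t →
      rf ^ (L * t) ≤ M * Real.exp (s * t) * (rc ^ (L' * t - 2) * E2) := by
    intro t ht
    have ht0 : t0 ≤ t := le_trans (le_max_left _ _) ht
    have ht2 : 2 ≤ t := le_trans (le_max_right _ _) ht
    have hLt : 2 ≤ L * t := le_trans ht2 (Nat.le_mul_of_pos_left t hLpos)
    have hL't : 2 ≤ L' * t := le_trans ht2 (Nat.le_mul_of_pos_left t hL'pos)
    have hlow := excitedRatio_lower (T := L * t) hW hLt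
    have hmid := HT t ht0
    have hup := excitedRatio_upper hW' hL't
    have hEc : 0 < excitedRatio L' β' (L' * t) := excitedRatio_pos hW' hL't
    have hMe : 0 ≤ M * Real.exp (s * t) := by
      have hpos : 0 < M * Real.exp (s * t) * excitedRatio L' β' (L' * t) :=
        lt_of_lt_of_le (lt_of_lt_of_le (pow_pos hrf _) hlow) hmid
      by_contra hneg
      push Not at hneg
      have : M * Real.exp (s * t) * excitedRatio L' β' (L' * t) ≤ 0 :=
        mul_nonpos_of_nonpos_of_nonneg hneg.le hEc.le
      linarith
    calc rf ^ (L * t) ≤ excitedRatio L β (L * t) := hlow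
      _ ≤ M * Real.exp (s * t) * excitedRatio L' β' (L' * t) := hmid
      _ ≤ M * Real.exp (s * t) * (rc ^ (L' * t - 2) * E2) := mul_le_mul_of_nonneg_left hup hMe
  -- rewrite as (rf^L)^t ≤ K · (e^{s} rc^{L'})^t with K = |M| E2 / rc²
  have hkey : ∀ t : ℕ, t1 ≤ t →
      (rf ^ L) ^ t ≤ (|M| * E2 / rc ^ 2) * (Real.exp s * rc ^ L') ^ t := by
    intro t ht
    have ht2 : 2 ≤ t := le_trans (le_max_right _ _) ht
    have hL't : 2 ≤ L' * t := le_trans ht2 (Nat.le_mul_of_pos_left t hL'pos)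
    have h := hchain t ht
    have hpow : rc ^ (L' * t - 2) = (rc ^ L') ^ t / rc ^ 2 := by
      rw [eq_div_iff (pow_pos hrc 2).ne', ← pow_mul, ← pow_add, Nat.sub_add_cancel hL't]
    have hexp : Real.exp (s * t) = Real.exp s ^ t := by
      rw [← Real.exp_nat_mul]; congr 1; ring
    rw [hpow, hexp] at h
    have hM : M ≤ |M| := le_abs_self M
    have hnn : 0 ≤ Real.exp s ^ t * ((rc ^ L') ^ t / rc ^ 2 * E2) := by positivity
    calc (rf ^ L) ^ t = rf ^ (L * t) := by rw [pow_mul]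
      _ ≤ M * Real.exp s ^ t * ((rc ^ L') ^ t / rc ^ 2 * E2) := h
      _ = M * (Real.exp s ^ t * ((rc ^ L') ^ t / rc ^ 2 * E2)) := by ring
      _ ≤ |M| * (Real.exp s ^ t * ((rc ^ L') ^ t / rc ^ 2 * E2)) := mul_le_mul_of_nonneg_right hM hnn
      _ = (|M| * E2 / rc ^ 2) * (Real.exp s * rc ^ L') ^ t := by
          rw [mul_pow]; field_simp
  -- root test
  have hpowL : rf ^ L ≤ Real.exp s * rc ^ L' :=
    le_of_pow_le_mul_pow (pow_nonneg hrf.le L) (mul_pos (Real.exp_pos _) (pow_pos hrc L')) hkey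
  -- back to the cross-multiplied form of the crux
  have hcross : secondValue su2Rep L β ^ L * topValue su2Rep L' β' ^ L' ≤
      Real.exp s * (secondValue su2Rep L' β' ^ L' * topValue su2Rep L β ^ L) := by
    rw [hrfdef, hrcdef, div_pow, div_pow] at hpowL
    exact (cross_le_iff (pow_pos hbf L) (pow_pos hbc L')).2 hpowL
  simpa only [hsdef] using hcross

/-! ### §2. `SubOctaveBounded → SubOctaveTraceComparison` (the converse) and the equivalence -/

/-- **Crux ⇒ stub (converse)**: from `λ₁(β,L)^L·λ₀(β',L')^{L'} ≤ e^{CΛ²}·λ₁(β',L')^{L'}·λ₀(β,L)^L`, i.e. `(λ₁/λ₀)_f^L ≤ e^{CΛ²}(λ₁/λ₀)_c^{L'}`,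
together with `E_f(Lt) ≤ (λ₁/λ₀)_f^{Lt−2}·E_f(2)` and `(λ₁/λ₀)_c^{L't} ≤ E_c(L't)`: the sub-octave trace comparison for every `t ≥ 2` with
`M = E_f(2)/(λ₁/λ₀)_f²` — same constants `C, lam₀, L₀`. [cite: MontvayMunster1994, (3.145)] [cite: ReedSimonIV1978, Thm. XIII.1] -/
theorem subOctaveTraceComparison_of_subOctaveBounded (h : SubOctaveBounded) : SubOctaveTraceComparison := by
  obtain ⟨C, lam0, L0, hlam0, H⟩ := h
  refine ⟨C, lam0, L0, hlam0, ?_⟩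
  intro lam hlam hle L' _ L _ hL0 hL'L hL2 β β' hW hW' hm
  have hstep := H lam hlam hle L' L hL0 hL'L hL2 β β' hW hW' hm
  -- notation and positivity
  set s : ℝ := C * luscherLambda β L ^ 2 with hsdef
  have hbf : 0 < topValue su2Rep L β := topValue_su2Rep_pos L β
  have hbc : 0 < topValue su2Rep L' β' := topValue_su2Rep_pos L' β'
  set rf : ℝ := secondValue su2Rep L β / topValue su2Rep L β with hrfdef
  set rc : ℝ := secondValue su2Rep L' β' / topValue su2Rep L' β' with hrcdef
  have hrf : 0 < rf := ratio_pos_of_window hW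
  have hrc : 0 < rc := ratio_pos_of_window hW'
  have hLpos : 1 ≤ L := Nat.pos_of_ne_zero (NeZero.ne L)
  have hL'pos : 1 ≤ L' := Nat.pos_of_ne_zero (NeZero.ne L')
  -- Step 1: ratio form of the crux inequality, `rf^L ≤ e^s · rc^{L'}`
  have hcross : secondValue su2Rep L β ^ L * topValue su2Rep L' β' ^ L' ≤
      Real.exp s * (secondValue su2Rep L' β' ^ L' * topValue su2Rep L β ^ L) := by
    simpa only [hsdef] using hstep
  have hpowL : rf ^ L ≤ Real.exp s * rc ^ L' := by
    rw [hrfdef, hrcdef, div_pow, div_pow]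
    exact (cross_le_iff (pow_pos hbf L) (pow_pos hbc L')).1 hcross
  -- Step 2: the trace comparison for every `t ≥ 2`
  refine ⟨excitedRatio L β 2 / rf ^ 2, 2, fun t ht => ?_⟩
  have hLt : 2 ≤ L * t := le_trans ht (Nat.le_mul_of_pos_left t hLpos)
  have hL't : 2 ≤ L' * t := le_trans ht (Nat.le_mul_of_pos_left t hL'pos)
  have hEf2 : 0 < excitedRatio L β 2 := excitedRatio_pos hW le_rfl
  have hEc : (rc ^ L') ^ t ≤ excitedRatio L' β' (L' * t) := by
    rw [← pow_mul]; exact excitedRatio_lower hW' hL't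
  -- `E_f(Lt) ≤ (rf^L)^t / rf² · E_f(2)`
  have hup : excitedRatio L β (L * t) ≤ (rf ^ L) ^ t / rf ^ 2 * excitedRatio L β 2 := by
    have h := excitedRatio_upper hW hLt
    have he : rf ^ (L * t - 2) = (rf ^ L) ^ t / rf ^ 2 := by
      rw [eq_div_iff (pow_pos hrf 2).ne', ← pow_mul, ← pow_add, Nat.sub_add_cancel hLt]
    rw [he] at h
    exact h
  have hmid : (rf ^ L) ^ t ≤ (Real.exp s * rc ^ L') ^ t := pow_le_pow_left₀ (pow_nonneg hrf.le L) hpowL t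
  have hexp : Real.exp (s * t) = Real.exp s ^ t := by
    rw [← Real.exp_nat_mul]; congr 1; ring
  rw [hexp]
  have hrf2 : 0 < rf ^ 2 := pow_pos hrf 2
  calc excitedRatio L β (L * t) ≤ (rf ^ L) ^ t / rf ^ 2 * excitedRatio L β 2 := hup
    _ ≤ (Real.exp s * rc ^ L') ^ t / rf ^ 2 * excitedRatio L β 2 :=
        mul_le_mul_of_nonneg_right (div_le_div_of_nonneg_right hmid hrf2.le) hEf2.le
    _ = excitedRatio L β 2 / rf ^ 2 * (Real.exp s ^ t * (rc ^ L') ^ t) := by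
        rw [mul_pow]; ring
    _ ≤ excitedRatio L β 2 / rf ^ 2 * (Real.exp s ^ t * excitedRatio L' β' (L' * t)) :=
        mul_le_mul_of_nonneg_left (mul_le_mul_of_nonneg_left hEc (pow_nonneg (Real.exp_pos _).le t))
          (div_pos hEf2 hrf2).le
    _ = excitedRatio L β 2 / rf ^ 2 * Real.exp s ^ t * excitedRatio L' β' (L' * t) := by ring

/-- ★ **The `trace` line of crux `SubOctaveBounded` is an exact reformulation**: `SubOctaveTraceComparison ↔ SubOctaveBounded` (same constants
`C, lam₀, L₀` both ways).  Difficulty reduction of the registered skeleton's open stub relative to the crux: none.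
[cite: MontvayMunster1994, (3.145)] -/
theorem subOctaveTraceComparison_iff : SubOctaveTraceComparison ↔ SubOctaveBounded :=
  ⟨subOctaveBounded_of_subOctaveTraceComparison, subOctaveTraceComparison_of_subOctaveBounded⟩

/-! ### §3. Hierarchy: the retired all-pairs step with the R1 allowance implies BOTH live step cruxes -/

/-- **`UniformStepScaling`-R1 ⇒ `OctaveStepDecay ∧ SubOctaveBounded`.**  The retired rank-2 crux in its repaired form R1 (all pairs
`L₀ ≤ L' ≤ L ≤ 2L'`, slack `exp(CΛ²/L'^σ + D(1/β' − 1/β))`; hypothesis spelled out verbatim as in `CutoffLadder.femtoGapOfRecord_of_ladderR1`)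
implies both live step cruxes: the tower pairs over the base `max L₀ 1` are among its pairs (slack unchanged), and on a sub-octave pair the slack is
BOUNDED — `CΛ²/L'^σ ≤ max(C,0)·Λ²` since `L'^σ ≥ 1`, and `D(1/β' − 1/β) ≤ D/β' ≤ D·Λ³/2 ≤ D·lam₀·Λ²` (`inv_le_half_luscherLambda_cube`, matched
label, `Λ ≤ 2·lam ≤ 2·lam₀`).  The converse is not claimed. [cite: AllesFeoPanagopoulos1997, eq. (3.7)] [cite: LuscherWeiszWolff1991] -/
theorem stepCruxes_of_uniformStepR1
    (hS : ∃ (C σ D lam0 : ℝ) (L0 : ℕ), 0 < σ ∧ 0 < lam0 ∧ 0 ≤ D ∧ ∀ lam : ℝ, 0 < lam → lam ≤ lam0 →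
      ∀ (L' : ℕ) [NeZero L'] (L : ℕ) [NeZero L], L0 ≤ L' → L' ≤ L → L ≤ 2 * L' →
        ∀ β β' : ℝ, InFemtoWindow lam β L → InFemtoWindow lam β' L' → luscherLambda β L = luscherLambda β' L' →
          secondValue su2Rep L β ^ L * topValue su2Rep L' β' ^ L' ≤
            Real.exp (C * luscherLambda β L ^ 2 / (L' : ℝ) ^ σ + D * (1 / β' - 1 / β)) *
              (secondValue su2Rep L' β' ^ L' * topValue su2Rep L β ^ L)) :
    OctaveStepDecay ∧ SubOctaveBounded := by
  obtain ⟨C, σ, D, lam0, L0, hσ, hlam0, hD, H⟩ := hS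
  constructor
  · refine ⟨C, σ, D, lam0, max L0 1, lt_of_lt_of_le zero_lt_one (le_max_right _ _), hσ, hlam0, hD, ?_⟩
    intro lam hlam hle i L' _ L _ hL' hL β β' hW hW' hm
    have h1 : L0 ≤ L' := by
      calc L0 ≤ max L0 1 := le_max_left _ _
        _ ≤ max L0 1 * 2 ^ i := Nat.le_mul_of_pos_right _ (Nat.two_pow_pos i)
        _ = L' := hL'.symm
    exact H lam hlam hle L' L h1 (by omega) (by omega) β β' hW hW' hm
  · refine ⟨max C 0 + D * lam0, lam0, L0, hlam0, ?_⟩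
    intro lam hlam hle L' _ L _ hL0 hL'L hL2 β β' hW hW' hm
    have h := H lam hlam hle L' L hL0 hL'L (by omega) β β' hW hW' hm
    have hβ : 0 < β := by linarith [hW.1]
    have hβ' : 0 < β' := by linarith [hW'.1]
    -- the running parameter of the pair
    have hinv : 1 / β' ≤ luscherLambda β' L' ^ 3 / 2 := CutoffLadder.inv_le_half_luscherLambda_cube hlam hW'
    rw [← hm] at hinv
    set l : ℝ := luscherLambda β L with hl
    have hl2 : l ≤ 2 * lam := hW.2.2
    have hL'1 : (1 : ℝ) ≤ (L' : ℝ) := by exact_mod_cast NeZero.one_le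
    have hpow : (1 : ℝ) ≤ (L' : ℝ) ^ σ := Real.one_le_rpow hL'1 hσ.le
    have hl2nn : 0 ≤ l ^ 2 := sq_nonneg l
    -- `CΛ²/L'^σ ≤ max(C,0)·Λ²`
    have hA : C * l ^ 2 / (L' : ℝ) ^ σ ≤ max C 0 * l ^ 2 :=
      calc C * l ^ 2 / (L' : ℝ) ^ σ ≤ max C 0 * l ^ 2 / (L' : ℝ) ^ σ :=
            div_le_div_of_nonneg_right (mul_le_mul_of_nonneg_right (le_max_left _ _) hl2nn) (by positivity)
        _ ≤ max C 0 * l ^ 2 := div_le_self (mul_nonneg (le_max_right _ _) hl2nn) hpow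
    -- `D(1/β' − 1/β) ≤ D·lam₀·Λ²`
    have hB : D * (1 / β' - 1 / β) ≤ D * lam0 * l ^ 2 := by
      have h2 : l ^ 3 / 2 ≤ lam0 * l ^ 2 := by
        have e1 : l ^ 3 / 2 = (l / 2) * l ^ 2 := by ring
        rw [e1]
        exact mul_le_mul_of_nonneg_right (by linarith) hl2nn
      have h3 : 0 < 1 / β := by positivity
      calc D * (1 / β' - 1 / β) ≤ D * (1 / β') := mul_le_mul_of_nonneg_left (by linarith) hD
        _ ≤ D * (lam0 * l ^ 2) := mul_le_mul_of_nonneg_left (hinv.trans h2) hD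
        _ = D * lam0 * l ^ 2 := by ring
    have hslack : C * l ^ 2 / (L' : ℝ) ^ σ + D * (1 / β' - 1 / β) ≤ (max C 0 + D * lam0) * l ^ 2 := by
      have e2 : (max C 0 + D * lam0) * l ^ 2 = max C 0 * l ^ 2 + D * lam0 * l ^ 2 := by ring
      rw [e2]
      exact add_le_add hA hB
    have hpos : 0 ≤ secondValue su2Rep L' β' ^ L' * topValue su2Rep L β ^ L :=
      mul_nonneg (pow_nonneg (secondValue_su2Rep_pos hβ').le _) (pow_nonneg (topValue_su2Rep_pos L β).le _)
    exact h.trans (mul_le_mul_of_nonneg_right (Real.exp_le_exp.mpr hslack) hpos)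

end Summit.QuantumFields.YangMills.Theorems.FemtoCutoffLadder.Trace

end
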